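import Summits.Langlands.Langlands.Theorems.PicardMuOrdinaryMuOrdinaryFamilyRTThorneCompanionsReduction
import Literature.NumberTheory.GaloisRepresentations.PadicAlgClPointsAutomaticContinuity
import Literature.NumberTheory.GaloisRepresentations.PadicPointsOfCompleteLocalRings
import Literature.NumberTheory.GaloisRepresentations.LocalKroneckerWeberInertiaProofs
import Literature.NumberTheory.EllipticCurves.ShaRestriction
import HarnessLib

/-!
# Crux `MuOrdinaryFamilyRT` (stmt-Langlands-13757), line `thorne-minimal-lift`: the provable halves of
# G3 `Missing.arithmeticPointsNearPicard` and its reduction to the weight-space core (stub `stub_arithmeticPoints`)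

G3 (…ThorneCompanionsDebts § 3, registered stub `stub_arithmeticPoints` of the line) says: for a module-finite
family `𝓕 : OrdFamily f ι e S₀ ρ_C` of dimension `≥ 4` through the Picard point and a Galois CM quadratic
`F'/K` with `3` split from `F'⁺`, there are a finite `E/ℚ₃` and a set `D` of `E`-integral weights
`κ : 𝓕.Λ → ℚ̄₃` accumulating `3`-adically at the Picard weight `κ_C = j ∘ x ∘ (Λ → R)` such that every
`ℚ̄₃`-point `y` of `𝓕.R` over `D` is (i) `𝔪_R`-adically continuous, (ii) integral, (iii) `ρ_y|Γ_{F'}` is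
polarized in trace form with exponent `𝓕.m`, and (iv) at every `w ∣ 3` of `F'`, for THE local Artin map,
Borel with the diagonal inertial characters of a labelled weight with gaps `≥ 2`.

This file (proofs only, no definition) lands the parts of G3 that the tree can prove, for ALL points over
ALL integral weights, and the kernel-checked reduction of G3 to what it cannot:

* § 1 `arithmeticPoints_continuous_integral` — (i)–(ii): a point whose weight has values of norm `≤ 1` is
  integral (`R` is integral over `Λ`; `norm_le_one_of_eval₂_eq_zero`) and then AUTOMATICALLY `𝔪_R`-adically
  continuous (`ℤ̄₃`-points of Noetherian local rings receiving `ℤ₃` are local and continuous: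
  `padicAlgClInt_exists_forall_norm_map_le_of_mem_pow`).  No `E`, no accumulation, no dimension hypothesis.
* § 2 `arithmeticPoints_polarized` — (iii) for every integral point: `𝓕.polarized` pushed through `y`
  (an integral `y` restricts to THE inclusion on `ℤ₃`, `PadicInt.coe_ringHom_valuationSubring_apply`, so the
  cyclotomic factor is respected), the complex conjugation moved to the conjugate dictated by the tower
  `Γ_{F'} → Γ_K → Γ_ℚ` of chosen restriction maps (`exists_absGaloisRestrict_comp_eq_conj`, from the tree's
  `absGaloisRestrict_isConj_of_algHom_holds`; conjugates of complex conjugations are complex conjugations),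
  and `ε_K ∘ res = ε_{F'}` (`cyclotomicCharacter_absGaloisRestrict`).
* § 3 `arithmeticPoints_decompositionTransport` — the Galois-theoretic half of (iv): for `w ∣ 3` of `F'`
  the decomposition group `Γ_{F'_w} → Γ_{F'} → Γ_K` is `γ · res_{K_v}(φ ·) · γ⁻¹` for the place `v ∣ 3` of
  `K` below `w`, some `γ ∈ Γ_K` and the restriction `φ : Γ_{F'_w} → Γ_{K_v}` along `K_v → F'_w`
  (`adicCompletionMap`), and `φ(I_{F'_w}) ≤ I_{K_v}` (`absInertia_map_absGaloisRestrict_le_holds`); along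
  `(γ, φ)` the B-ordinary frame of `OrdFamily.ordinaryAt` at `v` becomes a Borel frame at `w` whose
  diagonal inertial characters are `y ∘ wt v i ∘ φ` (`pointRep_transport`, `isBorelOfWeightAt_pointRep`).
* § 4 `stub_arithmeticPoints_of : (W) → Missing.arithmeticPointsNearPicard` — G3 is EXACTLY its
  weight-space core (W) "arithmetic weights accumulate at the Picard weight": a finite `E` and, for every
  `M`, an `E`-integral `κ : Λ → ℚ̄₃` within `3^{-M}` of `κ_C` uniformly on `Λ`, gap-`≥ 2` weights `λ_w`, and
  at each `w ∣ 3` a transport `(v, γ, φ)` along which, on an open subgroup of inertia mapped into `I_{K_v}`,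
  `κ ∘ wt v i ∘ φ = ∏_τ τ(Art⁻¹ ·)^{-(λ_{w,τ,3-i}+i-1)}` for THE Artin map.  (W) mentions no point of `𝓕.R`
  and no representation.

What is NOT here, and why (W) is out of reach of the tree (report `stub_arithmeticPoints.md` of the
line): nothing in `OrdFamily` ties the weight characters `wt` to an Artin map — the only anchor is
`ends` (the CYCLOTOMIC character at `x_C`) — so any proof of (W) needs `ε ∘ Art_{K_λ} = N_{K_λ/ℚ₃}⁻¹` on
units for THE Artin map `canonicalArtin` (a Hilbert-`ε` pinned only by the undischarged named facts
`exists_isLocalArtinMap`, `IsLocalArtinMap.unique`, which moreover do not compute it on units), the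
structure `I_{K_λ}^{ab} ≅ 𝒪_{K_λ}ˣ ≅ μ₆ × ℤ₃²`, and a presentation of `Λ` as the `m`-polarized weight space
(ring homomorphisms `Λ → 𝒪_E` with PRESCRIBED inertial characters; the axioms `weightsGenerate`,
`closedRange`, `dim_le` give topological generation, not freeness, and the polarization involution of the
rows is order-reversing only by Hodge–Tate theory of `ρ_C`).  None of these is in the tree.
-/

set_option linter.dupNamespace false -- `Summit.Langlands.Langlands.…` is the problem's namespace

namespace Summit.Langlands.Langlands.Cruxes.MuOrdinaryFamilyRT.ThorneMinimalLift

open scoped NumberField Polynomial Matrix Classical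
open Field IsDedekindDomain Polynomial
open Literature.NumberTheory.GaloisRepresentations Literature.NumberTheory.Automorphic
open Summit.Langlands.Langlands.Cruxes.MuOrdinaryFamilyRT.CharZeroDominance

noncomputable section

variable {f : ℤ[X]} {ι : PadicAlgCl 3 ≃+* ℂ} {e : K →+* ℂ} {S₀ : Finset (HeightOneSpectrum (𝓞 K))}
  {ρC : FramedGaloisRep K (PadicAlgCl 3) 3}

/-! ## 1. Points over integral weights are integral and `𝔪_R`-adically continuous -/

/-- **Integrality.**  If `𝓕.R` is module-finite over `𝓕.Λ` and the point `y : 𝓕.R → ℚ̄₃` has norm `≤ 1`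
on (the image of) `Λ`, then `‖y r‖ ≤ 1` for every `r`: `r` is a root of a monic polynomial over `Λ`, so
`y r` is a root of a monic polynomial with coefficients in the closed unit ball. -/
theorem norm_point_le_one (𝓕 : OrdFamily f ι e S₀ ρC) [Module.Finite 𝓕.Λ 𝓕.R]
    (y : 𝓕.R →+* PadicAlgCl 3) (hκ : ∀ a : 𝓕.Λ, ‖y (algebraMap 𝓕.Λ 𝓕.R a)‖ ≤ 1) (r : 𝓕.R) :
    ‖y r‖ ≤ 1 := by
  obtain ⟨P, hPmonic, hP⟩ := Algebra.IsIntegral.isIntegral (R := 𝓕.Λ) r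
  have h : P.eval₂ (y.comp (algebraMap 𝓕.Λ 𝓕.R)) (y r) = 0 := by
    rw [← Polynomial.hom_eval₂, hP, map_zero]
  exact norm_le_one_of_eval₂_eq_zero (y.comp (algebraMap 𝓕.Λ 𝓕.R)) hκ hPmonic h

/-- **Automatic continuity.**  An integral point `y : 𝓕.R → ℤ̄₃ ⊂ ℚ̄₃` of the complete Noetherian local
`𝒪`-algebra `𝓕.R` is `𝔪_R`-adically continuous: for every `N` some power `𝔪_R^M` is mapped into the ball
of radius `3^{-N}` (tree: `padicAlgClInt_exists_forall_norm_map_le_of_mem_pow`, locality of `ℤ̄₃`-points of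
local rings receiving `ℤ₃` plus finite generation of `𝔪_R`). -/
theorem point_continuous (𝓕 : OrdFamily f ι e S₀ ρC) (y : 𝓕.R →+* PadicAlgCl 3)
    (hy : ∀ r : 𝓕.R, ‖y r‖ ≤ 1) (N : ℕ) :
    ∃ M : ℕ, ∀ r ∈ IsLocalRing.maximalIdeal 𝓕.R ^ M, ‖y r‖ ≤ ((3 : ℝ)⁻¹) ^ N := by
  let φ : 𝓕.R →+* (PadicAlgCl.valued 3).v.valuationSubring :=
    y.codRestrict _ fun r => (padicAlgCl_mem_valuationSubring_iff 3 _).2 (hy r)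
  let i : ℤ_[3] →+* 𝓕.R := (algebraMap 𝓕.𝒪 𝓕.R).comp (algebraMap ℤ_[3] 𝓕.𝒪)
  obtain ⟨M, hM⟩ := padicAlgClInt_exists_forall_norm_map_le_of_mem_pow 3 i
    (IsNoetherian.noetherian _) φ N
  refine ⟨M, fun r hr => ?_⟩
  have h3 : ‖((3 : ℕ) : PadicAlgCl 3)‖ = (3 : ℝ)⁻¹ := by
    rw [← map_natCast (algebraMap ℚ_[3] (PadicAlgCl 3)) 3]
    change ‖(((3 : ℕ) : ℚ_[3]) : PadicAlgCl 3)‖ = _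
    rw [PadicAlgCl.norm_extends, Padic.norm_p]
    norm_num
  have := hM r hr
  rw [h3] at this
  exact this

/-- **Provable part (i) of G3, registered helper `arithmeticPoints_continuous_integral`.**  For a family
`𝓕` with `𝓕.R` module-finite over `𝓕.Λ`, EVERY `ℚ̄₃`-point `y` of `𝓕.R` whose weight `y ∘ (Λ → R)` takes values
of norm `≤ 1` is `𝔪_R`-adically continuous and integral — clauses (i)–(ii) of the point conditions of
`Missing.arithmeticPointsNearPicard`, for all points over ALL integral weights (no accumulation, no `E`, no
dimension hypothesis needed). -/
theorem arithmeticPoints_continuous_integral : ∀ (f : ℤ[X]) (ι : PadicAlgCl 3 ≃+* ℂ) (e : K →+* ℂ) (S₀ : Finset (HeightOneSpectrum (𝓞 K))) (ρC : FramedGaloisRep K (PadicAlgCl 3) 3) (𝓕 : OrdFamily f ι e S₀ ρC), Module.Finite 𝓕.Λ 𝓕.R → ∀ y : 𝓕.R →+* PadicAlgCl 3, (∀ a : 𝓕.Λ, ‖y (algebraMap 𝓕.Λ 𝓕.R a)‖ ≤ 1) → (∀ N : ℕ, ∃ M : ℕ, ∀ r ∈ IsLocalRing.maximalIdeal 𝓕.R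 ^ M, ‖y r‖ ≤ ((3 : ℝ)⁻¹) ^ N) ∧ (∀ r : 𝓕.R, ‖y r‖ ≤ 1) := by
  intro f ι e S₀ ρC 𝓕 hfin y hκ
  have hy : ∀ r : 𝓕.R, ‖y r‖ ≤ 1 := norm_point_le_one 𝓕 y hκ
  exact ⟨point_continuous 𝓕 y hy, hy⟩

/-! ## 2. The point representations restricted to `Γ_{F'}` are polarized in trace form -/

/-- **Tower conjugacy of the chosen restriction maps.**  For fields `k ⊂ M ⊂ L` (`IsScalarTower k M L`)
the composite of the chosen restrictions `Γ_L → Γ_M → Γ_k` agrees with the chosen restriction `Γ_L → Γ_k`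
up to a FIXED inner automorphism of `Γ_k`: both are compatible with a `k`-embedding `k̄ → L̄` (tree
`absGaloisRestrict_isConj_of_algHom_holds`).  Used with `k = ℚ ⊂ K ⊂ F'` (polarization) and with
`K ⊂ F' ⊂ F'_w`, `K ⊂ K_v ⊂ F'_w` (decomposition groups). -/
theorem exists_absGaloisRestrict_comp_eq_conj (k M L : Type*) [Field k] [Field M] [Field L]
    [Algebra k M] [Algebra k L] [Algebra M L] [IsScalarTower k M L] :
    ∃ γ : absoluteGaloisGroup k, ∀ σ : absoluteGaloisGroup L,
      absGaloisRestrict k M (absGaloisRestrict M L σ) = γ * absGaloisRestrict k L σ * γ⁻¹ := by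
  let φ : AlgebraicClosure k →+* AlgebraicClosure L :=
    (absClosureEmbedding M L).toRingHom.comp (absClosureEmbedding k M).toRingHom
  have hφ : ∀ x : k, φ (algebraMap k (AlgebraicClosure k) x) = algebraMap k (AlgebraicClosure L) x := by
    intro x
    simp only [φ, RingHom.coe_comp, Function.comp_apply, AlgHom.toRingHom_eq_coe, AlgHom.coe_toRingHom,
      AlgHom.commutes]
    rw [IsScalarTower.algebraMap_apply k M (AlgebraicClosure M), AlgHom.commutes,
      ← IsScalarTower.algebraMap_apply]
  let ι' : AlgebraicClosure k →ₐ[k] AlgebraicClosure L := { φ with commutes' := hφ }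
  refine absGaloisRestrict_isConj_of_algHom_holds k L ι'
    (fun σ => absGaloisRestrict k M (absGaloisRestrict M L σ)) fun σ x => ?_
  change absClosureEmbedding M L (absClosureEmbedding k M (_ • x)) =
    σ • absClosureEmbedding M L (absClosureEmbedding k M x)
  rw [absGaloisRestrict_apply_smul, absGaloisRestrict_apply_smul]

/-- **Restriction intertwines the outer actions of `Γ_ℚ` on `Γ_{F'}` and on `Γ_K`** up to replacing the
acting element by a fixed conjugate: `res_{K}^{F'}(θ^{F'}_c σ) = θ^{K}_{τcτ⁻¹}(res_K^{F'} σ)`. -/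
theorem exists_absGaloisRestrict_absGaloisOuterConj_eq (F' : Type) [Field F'] [NumberField F']
    [Algebra K F'] [IsGalois ℚ F'] :
    ∃ τ : absoluteGaloisGroup ℚ, ∀ (c : absoluteGaloisGroup ℚ) (σ : absoluteGaloisGroup F'),
      absGaloisRestrict K F' (absGaloisOuterConj ℚ F' c σ) =
        absGaloisOuterConj ℚ K (τ * c * τ⁻¹) (absGaloisRestrict K F' σ) := by
  obtain ⟨τ, hτ⟩ := exists_absGaloisRestrict_comp_eq_conj ℚ K F'
  refine ⟨τ, fun c σ => absGaloisRestrict_injective ℚ K ?_⟩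
  rw [hτ, absGaloisRestrict_absGaloisOuterConj, absGaloisRestrict_absGaloisOuterConj, hτ]
  group

/-- A conjugate of a complex conjugation is a complex conjugation (compose the embedding `K̄ → ℂ` with
`γ⁻¹`). -/
-- adapted from Literature.NumberTheory.GaloisRepresentations.IsComplexConjugation.conj_mul
-- (EllipticCurves/HeegnerPointsKolyvaginProp81FrobeniusProofs, not imported here)
theorem isComplexConjugation_conj {L : Type*} [Field L] {φ : L →+* ℝ} {c : absoluteGaloisGroup L}
    (hc : IsComplexConjugation φ c) (γ : absoluteGaloisGroup L) :
    IsComplexConjugation φ (γ * c * γ⁻¹) := by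
  obtain ⟨i, hi, hic⟩ := isComplexConjugation_iff.mp hc
  refine isComplexConjugation_iff.mpr
    ⟨i.comp ((show AlgebraicClosure L ≃ₐ[L] AlgebraicClosure L from γ⁻¹) :
      AlgebraicClosure L →+* AlgebraicClosure L), ?_, fun x ↦ ?_⟩
  · rw [RingHom.comp_assoc]
    convert hi using 2
    ext x
    exact (show AlgebraicClosure L ≃ₐ[L] AlgebraicClosure L from γ⁻¹).commutes x
  · change i (γ⁻¹ • (γ * c * γ⁻¹) • x) = starRingEnd ℂ (i (γ⁻¹ • x))
    rw [← mul_smul, ← mul_assoc, ← mul_assoc, inv_mul_cancel, one_mul, mul_smul, hic]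

/-- The trace of the point representation is the point applied to the trace of the family. -/
theorem trace_pointRep (𝓕 : OrdFamily f ι e S₀ ρC) (y : 𝓕.R →+* PadicAlgCl 3)
    (g : absoluteGaloisGroup K) : (pointRep 𝓕 y g).val.trace = y (𝓕.ρ g).val.trace := by
  simp only [Matrix.trace, Matrix.diag_apply, pointRep_val_apply, map_sum]

/-- An INTEGRAL point is compatible with the structure maps from `ℤ₃`: `y ∘ (ℤ₃ → 𝒪 → R)` is the
inclusion `ℤ₃ ⊂ ℚ̄₃` (every ring homomorphism `ℤ₃ → ℤ̄₃` is the inclusion; tree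
`PadicInt.coe_ringHom_valuationSubring_apply`). -/
theorem point_algebraMap_padicInt (𝓕 : OrdFamily f ι e S₀ ρC) (y : 𝓕.R →+* PadicAlgCl 3)
    (hy : ∀ r : 𝓕.R, ‖y r‖ ≤ 1) (z : ℤ_[3]) :
    y (algebraMap 𝓕.𝒪 𝓕.R (algebraMap ℤ_[3] 𝓕.𝒪 z)) = algebraMap ℤ_[3] (PadicAlgCl 3) z := by
  let φ : 𝓕.R →+* (PadicAlgCl.valued 3).v.valuationSubring :=
    y.codRestrict _ fun r => (padicAlgCl_mem_valuationSubring_iff 3 _).2 (hy r)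
  have h := PadicInt.coe_ringHom_valuationSubring_apply 3
    (φ.comp ((algebraMap 𝓕.𝒪 𝓕.R).comp (algebraMap ℤ_[3] 𝓕.𝒪))) z
  exact h

/-- **Provable part (ii) of G3, registered helper `arithmeticPoints_polarized`.**  For EVERY integral
`ℚ̄₃`-point `y` of a family `𝓕` and every Galois number field `F' ⊃ K`, the restriction `ρ_y|Γ_{F'}` is
polarized in trace form with the family's exponent `𝓕.m` (`TracePolarizedHom`): push `𝓕.polarized`
through `y` (integrality makes `y` compatible with `ℤ₃ → R`, so the cyclotomic factor is respected), move
the complex conjugation `c` to the conjugate `τcτ⁻¹` dictated by the tower of chosen restriction maps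
(`exists_absGaloisRestrict_absGaloisOuterConj_eq`), and use `ε_K ∘ res = ε_{F'}`
(`cyclotomicCharacter_absGaloisRestrict`). -/
theorem arithmeticPoints_polarized : ∀ (f : ℤ[X]) (ι : PadicAlgCl 3 ≃+* ℂ) (e : K →+* ℂ) (S₀ : Finset (HeightOneSpectrum (𝓞 K))) (ρC : FramedGaloisRep K (PadicAlgCl 3) 3) (𝓕 : OrdFamily f ι e S₀ ρC) (y : 𝓕.R →+* PadicAlgCl 3), (∀ r : 𝓕.R, ‖y r‖ ≤ 1) → ∀ (F' : Type) [Field F'] [NumberField F'] [Algebra K F'] [IsGalois ℚ F'], TracePolarizedHom F' 𝓕.m ((pointRep 𝓕 y).comp (absGaloisRestrict K F').toMonoidHom) := by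
  intro f ι e S₀ ρC 𝓕 y hy F' _ _ _ _ c hc σ
  obtain ⟨τ, hτ⟩ := exists_absGaloisRestrict_absGaloisOuterConj_eq F'
  have hpol := 𝓕.polarized (τ * c * τ⁻¹) (isComplexConjugation_conj hc τ) (absGaloisRestrict K F' σ)
  show (pointRep 𝓕 y (absGaloisRestrict K F' (absGaloisOuterConj ℚ F' c σ))).val.trace =
    algebraMap ℤ_[3] (PadicAlgCl 3) (((GaloisRep.cyclotomicCharacter F' 3 σ) ^ 𝓕.m : ℤ_[3]ˣ) : ℤ_[3]) *
      (pointRep 𝓕 y (absGaloisRestrict K F' σ⁻¹)).val.trace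
  rw [hτ c σ, trace_pointRep, trace_pointRep, hpol, map_mul, point_algebraMap_padicInt 𝓕 y hy,
    cyclotomicCharacter_absGaloisRestrict]
  simp only [map_inv]

/-! ## 3. Transport of the decomposition group at `w ∣ 3` of `F'` to the place `v` of `K` below it -/

/-- **Provable part (iii-a) of G3, registered helper `arithmeticPoints_decompositionTransport`.**  For a
number field `F' ⊃ K` and a place `w ∣ 3` of `F'` there are a place `v ∣ 3` of `K` (the place below `w`),
an element `γ ∈ Γ_K` and a continuous homomorphism `φ : Γ_{F'_w} → Γ_{K_v}` (restriction along the
continuous extension `K_v → F'_w` of `K → F'`) such that the decomposition group of `w` inside `Γ_K` —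
the composite of the chosen restrictions `Γ_{F'_w} → Γ_{F'} → Γ_K` — is `γ · res_{K_v}(φ ·) · γ⁻¹`, and
`φ` maps the inertia group of `F'_w` into that of `K_v` (tree: `absInertia_map_absGaloisRestrict_le_holds`).
Along `(γ, φ)` the B-ordinary frames of `OrdFamily.ordinaryAt` at `v` become Borel frames at `w`
(`pointRep_transport`, `isBorelOfWeightAt_pointRep`). -/
theorem arithmeticPoints_decompositionTransport : ∀ (F' : Type) [Field F'] [NumberField F'] [Algebra K F'] (w : HeightOneSpectrum (𝓞 F')), ((3 : ℕ) : 𝓞 F') ∈ w.asIdeal → ∃ (v : HeightOneSpectrum (𝓞 K)) (γ : absoluteGaloisGroup K) (φ : absoluteGaloisGroup (w.adicCompletion F') →ₜ* absoluteGaloisGroup (v.adicCompletion K)), (3 : 𝓞 K) ∈ v.asIdeal ∧ (∀ τ : absoluteGaloisGroup (w.adicCompletion F'), absGaloisRestrict K F' (absGaloisRestrict F' (w.adicCompletion F') τ) = γ * absGaloisRestrict K (v.adicCompletion K) (φ τ) * γ⁻¹) ∧ ∀ τ ∈ absInertia (w.adicCompletion F'), φ τ ∈ absInertia (v.adicCompletion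 K) := by
  intro F' _ _ _ w hw
  let v : HeightOneSpectrum (𝓞 K) := w.under (𝓞 K)
  haveI hover : w.asIdeal.LiesOver v.asIdeal := ⟨rfl⟩
  have hv3 : (3 : 𝓞 K) ∈ v.asIdeal := by
    change algebraMap (𝓞 K) (𝓞 F') 3 ∈ w.asIdeal
    rw [map_ofNat]
    exact_mod_cast hw
  letI : Algebra (v.adicCompletion K) (w.adicCompletion F') :=
    (Literature.NumberTheory.EllipticCurves.adicCompletionMap (K := K) F' v w).toAlgebra
  haveI : IsScalarTower K (v.adicCompletion K) (w.adicCompletion F') :=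
    IsScalarTower.of_algebraMap_eq fun x ↦
      (Literature.NumberTheory.EllipticCurves.adicCompletionMap_coe (K := K) F' v w x).symm
  let φ := absGaloisRestrict (v.adicCompletion K) (w.adicCompletion F')
  obtain ⟨γ₁, hγ₁⟩ := exists_absGaloisRestrict_comp_eq_conj K F' (w.adicCompletion F')
  obtain ⟨γ₂, hγ₂⟩ :=
    exists_absGaloisRestrict_comp_eq_conj K (v.adicCompletion K) (w.adicCompletion F')
  refine ⟨v, γ₁ * γ₂⁻¹, φ, hv3, fun τ => ?_, fun τ hτ => ?_⟩
  · rw [hγ₁, show absGaloisRestrict K (w.adicCompletion F') τ =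
        γ₂⁻¹ * absGaloisRestrict K (v.adicCompletion K) (φ τ) * γ₂ by rw [hγ₂]; group]
    group
  · exact absInertia_map_absGaloisRestrict_le_holds (v.adicCompletion K) (w.adicCompletion F')
      (Subgroup.mem_map_of_mem _ hτ)

/-- **Frames transport along `(γ, φ)`.**  If the decomposition group of `w` in `Γ_K` is
`γ · res_{K_v}(φ ·) · γ⁻¹`, then conjugating a frame `g` by `ρ_y(γ)` turns `ρ_y ∘ res_{K_v} ∘ φ` in the
frame `g` into `ρ_y|Γ_{F'} ∘ res_{F'_w}` in the frame `ρ_y(γ) g`. -/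
theorem pointRep_transport (𝓕 : OrdFamily f ι e S₀ ρC) (y : 𝓕.R →+* PadicAlgCl 3)
    {F' : Type} [Field F'] [NumberField F'] [Algebra K F'] {w : HeightOneSpectrum (𝓞 F')}
    {v : HeightOneSpectrum (𝓞 K)} {γ : absoluteGaloisGroup K}
    {φ : absoluteGaloisGroup (w.adicCompletion F') → absoluteGaloisGroup (v.adicCompletion K)}
    (hγ : ∀ τ : absoluteGaloisGroup (w.adicCompletion F'),
      absGaloisRestrict K F' (absGaloisRestrict F' (w.adicCompletion F') τ) =
        γ * absGaloisRestrict K (v.adicCompletion K) (φ τ) * γ⁻¹)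
    (g : GL (Fin 3) (PadicAlgCl 3)) (τ : absoluteGaloisGroup (w.adicCompletion F')) :
    (pointRep 𝓕 y γ * g)⁻¹ *
        ((pointRep 𝓕 y).comp (absGaloisRestrict K F').toMonoidHom)
          (absGaloisRestrict F' (w.adicCompletion F') τ) * (pointRep 𝓕 y γ * g) =
      g⁻¹ * Matrix.GeneralLinearGroup.map y (𝓕.ρ (absGaloisRestrict K (v.adicCompletion K) (φ τ))) * g := by
  show (pointRep 𝓕 y γ * g)⁻¹ * pointRep 𝓕 y (absGaloisRestrict K F' (absGaloisRestrict F' (w.adicCompletion F') τ)) *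
      (pointRep 𝓕 y γ * g) = g⁻¹ * pointRep 𝓕 y (absGaloisRestrict K (v.adicCompletion K) (φ τ)) * g
  rw [hγ, map_mul, map_mul, map_inv]
  group

/-! ## 4. G3 reduced to the existence of arithmetic weights near the Picard weight -/

/-- **Borel of weight `wt` at `w`, for the points over a weight with the right inertial characters.**  If the
decomposition group of `w` in `Γ_K` is `γ · res_{K_v}(φ ·) · γ⁻¹` and, on an open subgroup `U`, `φ` maps
(Weil) inertia of `F'_w` into the inertia of `K_v` where the weight of the point `y` has `i`-th character
`y(wt v i (φ ·)) = ∏_τ τ(Art⁻¹ ·)^{-(λ_{τ,3-i}+i-1)}`, then `ρ_y|Γ_{F'}` is Borel of weight `λ = wt` at `w`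
(`IsBorelOfWeightAt`): the frame is `ρ_y(γ) g` for the B-ordinary frame `g` of `OrdFamily.ordinaryAt` at `v`,
whose diagonal inertial characters ARE `y ∘ wt v i`. -/
theorem isBorelOfWeightAt_pointRep (𝓕 : OrdFamily f ι e S₀ ρC) (y : 𝓕.R →+* PadicAlgCl 3)
    {F' : Type} [Field F'] [NumberField F'] [Algebra K F'] (w : HeightOneSpectrum (𝓞 F'))
    {v : HeightOneSpectrum (𝓞 K)} (hv : (3 : 𝓞 K) ∈ v.asIdeal) {γ : absoluteGaloisGroup K}
    {φ : absoluteGaloisGroup (w.adicCompletion F') → absoluteGaloisGroup (v.adicCompletion K)}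
    (hγ : ∀ τ : absoluteGaloisGroup (w.adicCompletion F'),
      absGaloisRestrict K F' (absGaloisRestrict F' (w.adicCompletion F') τ) =
        γ * absGaloisRestrict K (v.adicCompletion K) (φ τ) * γ⁻¹)
    (art : LocalArtinData (w.adicCompletion F'))
    (wt : LabelledWeight (w.adicCompletion F') (PadicAlgCl 3) 3)
    (U : OpenSubgroup (absoluteGaloisGroup (w.adicCompletion F')))
    (hU : ∀ τw ∈ WeilGroup.inertia (w.adicCompletion F'), WeilGroup.toAbsGalois (w.adicCompletion F') τw ∈ U →
      φ (WeilGroup.toAbsGalois (w.adicCompletion F') τw) ∈ absInertia (v.adicCompletion K) ∧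
      ∀ i : Fin 3, y (algebraMap 𝓕.Λ 𝓕.R (𝓕.wt v i (φ (WeilGroup.toAbsGalois (w.adicCompletion F') τw)))) =
        (ordinaryWeightUnit wt i (art.artin τw) : PadicAlgCl 3)) :
    IsBorelOfWeightAt F' w art ((pointRep 𝓕 y).comp (absGaloisRestrict K F').toMonoidHom) wt := by
  obtain ⟨g, hup, hdiag⟩ := 𝓕.ordinaryAt y v hv
  refine ⟨pointRep 𝓕 y γ * g, U, fun τ => ?_, fun τw hτw hU' i => ?_⟩
  · rw [pointRep_transport 𝓕 y hγ g τ]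
    exact hup (φ τ)
  · obtain ⟨hin, hwt⟩ := hU τw hτw hU'
    rw [pointRep_transport 𝓕 y hγ g, hdiag _ hin i, hwt i]

/-- **`stub_arithmeticPoints` reduced to its weight-space core (registered as `stub_arithmeticPoints_of`).**
G3 `Missing.arithmeticPointsNearPicard` follows from the statement **(W) "arithmetic weights accumulate at the
Picard weight"**: for `𝓕`, `F'` as in G3 there are a finite `E/ℚ₃` and, for every `M`, an `E`-integral weight
`κ : Λ → ℚ̄₃` within `3^{-M}` of `κ_C = j ∘ x ∘ (Λ → R)` uniformly on `Λ`, and gap-`≥ 2` labelled weights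
`λ_w` (`w ∣ 3`), such that at every `w ∣ 3`, along SOME transport `(v, γ, φ)` of the decomposition group of `w`
to a place `v ∣ 3` of `K` (such transports exist: `arithmeticPoints_decompositionTransport`), the inertial
characters `κ ∘ wt v i ∘ φ` are, on an open subgroup of inertia mapped into `I_{K_v}`, the algebraic
characters `∏_τ τ(Art⁻¹ ·)^{-(λ_{τ,3-i}+i-1)}` of THE local Artin map (every canonical datum).  (W) is a
statement about the weight algebra `Λ`, its weight characters `wt`, the Picard weight and local class field
theory of `F'_w = K_λ` ONLY — no point of `𝓕.R`, no representation.  Proof of the reduction: `D :=` the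
`E`-integral weights carrying such `(λ_w, v, γ, φ, U)`; accumulation is (W); a point `y` over `κ ∈ D` is
continuous and integral (`arithmeticPoints_continuous_integral`), `ρ_y|Γ_{F'}` is polarized
(`arithmeticPoints_polarized`) and Borel of weight `λ_w` at `w` (`isBorelOfWeightAt_pointRep`).  What (W)
still needs (not in the tree): `Spec Λ` is the `m`-polarized weight space (Zariski density of arithmetic
weights near `κ_C` in the family's row order) and `ε ∘ Art_{K_λ} = N_{K_λ/ℚ₃}⁻¹` on units for THE Artin map
(local class field theory of `K_λ`; tree named facts `exists_isLocalArtinMap`, `IsLocalArtinMap.unique` do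
not pin the Artin map on units computably). -/
theorem stub_arithmeticPoints_of : (∀ (f : ℤ[X]) (ι : PadicAlgCl 3 ≃+* ℂ) (e : K →+* ℂ) (S₀ : Finset (HeightOneSpectrum (𝓞 K))) (ρC : FramedGaloisRep K (PadicAlgCl 3) 3) (𝓕 : OrdFamily f ι e S₀ ρC), Generic f → PicardInput f ι e S₀ ρC → MainClassPlus f S₀ ρC → ((4 : ℕ) : WithBot ℕ∞) ≤ ringKrullDim 𝓕.R → PotUnramifiedFamily 𝓕 → Module.Finite 𝓕.Λ 𝓕.R → ∀ (F' : Type) [Field F'] [NumberField F'] [Algebra K F'] [IsGalois ℚ F'] [NumberField.IsCMField F'], Module.finrank K F' = 2 → ThreeSplitFromMaximalReal F' → ∃ E : IntermediateField ℚ_[3] (PadicAlgCl 3), FiniteDimensional ℚ_[3] E ∧ ∀ M : ℕ, ∃ κ : 𝓕.Λ →+* PadicAlgCl 3, (∀ a : 𝓕.Λ, κ a ∈ E ∧ ‖κ a‖ ≤ 1) ∧ (∀ a : 𝓕.Λ, ‖κ a - 𝓕.j (𝓕.x (algebraMap 𝓕.Λ 𝓕.R a))‖ ≤ ((3 : ℝ)⁻¹)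 ^ M) ∧ ∃ wt : (w : HeightOneSpectrum (𝓞 F')) → LabelledWeight (w.adicCompletion F') (PadicAlgCl 3) 3, ∀ w : HeightOneSpectrum (𝓞 F'), ((3 : ℕ) : 𝓞 F') ∈ w.asIdeal → (∀ τ (i j : Fin 3), i < j → wt w τ j + 2 ≤ wt w τ i) ∧ ∃ (v : HeightOneSpectrum (𝓞 K)) (γ : absoluteGaloisGroup K) (φ : absoluteGaloisGroup (w.adicCompletion F') → absoluteGaloisGroup (v.adicCompletion K)), (3 : 𝓞 K) ∈ v.asIdeal ∧ (∀ τ : absoluteGaloisGroup (w.adicCompletion F'), absGaloisRestrict K F' (absGaloisRestrict F' (w.adicCompletion F') τ) = γ * absGaloisRestrict K (v.adicCompletion K) (φ τ) * γ⁻¹) ∧ ∀ art : LocalArtinData (w.adicCompletion F'), art.IsCanonical → ∃ U : OpenSubgroup (absoluteGaloisGroup (w.adicCompletion F')), ∀ τw ∈ WeilGroup.inertia (w.adicCompletion F'), WeilGroup.toAbsGalois (w.adicCompletion F') τw ∈ U → φ (WeilGroup.toAbsGalois (w.adicCompletion F') τw) ∈ absInertia (v.adicCompletion K) ∧ ∀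 i : Fin 3, κ (𝓕.wt v i (φ (WeilGroup.toAbsGalois (w.adicCompletion F') τw))) = (ordinaryWeightUnit (wt w) i (art.artin τw) : PadicAlgCl 3)) → Missing.arithmeticPointsNearPicard := by
  intro hW f ι e S₀ ρC 𝓕 hgen hin hM hdim hpur hfin F' _ _ _ _ _ hdeg hsplit
  obtain ⟨E, hE, hκ⟩ := hW f ι e S₀ ρC 𝓕 hgen hin hM hdim hpur hfin F' hdeg hsplit
  refine ⟨{κ | (∀ a : 𝓕.Λ, κ a ∈ E ∧ ‖κ a‖ ≤ 1) ∧
      ∃ wt : (w : HeightOneSpectrum (𝓞 F')) → LabelledWeight (w.adicCompletion F') (PadicAlgCl 3) 3,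
        ∀ w : HeightOneSpectrum (𝓞 F'), ((3 : ℕ) : 𝓞 F') ∈ w.asIdeal →
          (∀ τ (i j : Fin 3), i < j → wt w τ j + 2 ≤ wt w τ i) ∧
          ∃ (v : HeightOneSpectrum (𝓞 K)) (γ : absoluteGaloisGroup K)
            (φ : absoluteGaloisGroup (w.adicCompletion F') → absoluteGaloisGroup (v.adicCompletion K)),
            (3 : 𝓞 K) ∈ v.asIdeal ∧
            (∀ τ : absoluteGaloisGroup (w.adicCompletion F'),
              absGaloisRestrict K F' (absGaloisRestrict F' (w.adicCompletion F') τ) =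
                γ * absGaloisRestrict K (v.adicCompletion K) (φ τ) * γ⁻¹) ∧
            ∀ art : LocalArtinData (w.adicCompletion F'), art.IsCanonical →
              ∃ U : OpenSubgroup (absoluteGaloisGroup (w.adicCompletion F')),
                ∀ τw ∈ WeilGroup.inertia (w.adicCompletion F'),
                  WeilGroup.toAbsGalois (w.adicCompletion F') τw ∈ U →
                    φ (WeilGroup.toAbsGalois (w.adicCompletion F') τw) ∈ absInertia (v.adicCompletion K) ∧
                    ∀ i : Fin 3, κ (𝓕.wt v i (φ (WeilGroup.toAbsGalois (w.adicCompletion F') τw))) =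
                      (ordinaryWeightUnit (wt w) i (art.artin τw) : PadicAlgCl 3)},
    E, hE, fun κ hκD => hκD.1, fun M => ?_, fun y hy => ?_⟩
  · obtain ⟨κ, hint, hclose, hwt⟩ := hκ M
    exact ⟨κ, ⟨hint, hwt⟩, hclose⟩
  · obtain ⟨hint, wt, hwt⟩ := hy
    have hκ1 : ∀ a : 𝓕.Λ, ‖y (algebraMap 𝓕.Λ 𝓕.R a)‖ ≤ 1 := fun a => (hint a).2
    obtain ⟨hcont, hyint⟩ := arithmeticPoints_continuous_integral f ι e S₀ ρC 𝓕 hfin y hκ1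
    refine ⟨hcont, hyint, arithmeticPoints_polarized f ι e S₀ ρC 𝓕 y hyint F', wt, fun w hw =>
      ⟨(hwt w hw).1, fun art hart => ?_⟩⟩
    obtain ⟨v, γ, φ, hv, hγ, hart'⟩ := (hwt w hw).2
    obtain ⟨U, hU⟩ := hart' art hart
    exact isBorelOfWeightAt_pointRep 𝓕 y w hv hγ art (wt w) U hU

end

end Summit.Langlands.Langlands.Cruxes.MuOrdinaryFamilyRT.ThorneMinimalLift
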